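import Summits.CriticalPhenomena.SAWScalingLimit.Theses.SAWMassiveIsingTilt

/-!
# `SAWMassiveIsingTilt.CornerTransfer` (stmt-CriticalPhenomena-9865) — proved

Route `SAWMassiveIsingTilt` of `CriticalPhenomena/SAWScalingLimit`, support item (rank 9):

`CornerLaw → HexEndpointApproxExists → OneClassOnCriticalCurve → LatticeUniversality →
 SAWScalingLimit`.

This is the bookkeeping step that carries the route's hexagonal conclusion over to the summit's
square-lattice statement: the `y = 0` edge of the tilted interface family is the hexagonal SAW law
(`CornerLaw`), the target `OneClassOnCriticalCurve` gives SLE_{8/3} on the whole open critical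
curve and in particular at the SAW corner `(x_c(Hex), 0)`, and the shared transfer crux
`LatticeUniversality` moves the limit from `δHex` to `δℤ²`.

## Proof

Pure logic plus one `Filter.Tendsto.add`. Fix a Dobrushin domain `D` and a `δℤ²` endpoint
approximation `(a, b)`; `HexEndpointApproxExists` gives a hexagonal endpoint approximation
`(a', b')` of the same marked domain. Specialise `OneClassOnCriticalCurve` at `y = 0 ∈ [0, 1/√3)`:
the tilted interface laws `𝔓_{xc 0, 0}` from `a'_δ` to `b'_δ` converge in law to a chordal
SLE_{8/3} random curve `Γ`; since `xc 0 = hexCriticalFugacity`, `CornerLaw` says these tilted laws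
ARE the hexagonal SAW laws `hexSAWLaw D.carrier δ (a' δ) (b' δ)`. For the `δℤ²` laws take the
same `Γ` (measurability is automatic on the discrete σ-algebra, `SAW.aemeasurable_curve`) and, for
every bounded continuous `f` on `CurveClass ℂ`, write
`∫ f dP^{ℤ²}_δ = (∫ f dP^{ℤ²}_δ − ∫ f dP^{Hex}_δ) + ∫ f dP^{Hex}_δ → 0 + 𝔼 f(Γ)`
(`LatticeUniversality` and the hexagonal convergence, `Tendsto.add`, `sub_add_cancel`).

## References

* H. Duminil-Copin, S. Smirnov, *The connective constant of the honeycomb lattice equals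
  `√(2+√2)`*, Ann. of Math. 175 (2012), §4, Conjecture 1.
* G. F. Lawler, O. Schramm, W. Werner, *On the scaling limit of planar self-avoiding walk*, Proc.
  Sympos. Pure Math. 72 (2004), §3.4.2 and Prediction 1 (§4.1).
-/

noncomputable section

open MeasureTheory Filter Topology Set
open scoped NNReal ENNReal BoundedContinuousFunction
open Literature.Probability Literature.Probability.LatticeModels
  Literature.Probability.RandomPlanarGeometry
open Summit.CriticalPhenomena.SAWScalingLimit.Theses.SAWMassiveIsingTilt

namespace Summit.CriticalPhenomena.SAWScalingLimit.Theorems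

/-- **`SAWMassiveIsingTilt.CornerTransfer` (stmt-CriticalPhenomena-9865) holds**:
`CornerLaw → HexEndpointApproxExists → OneClassOnCriticalCurve → LatticeUniversality →
SAWScalingLimit`. Given a Dobrushin domain and a `δℤ²` endpoint approximation, pick a hexagonal
endpoint approximation (`HexEndpointApproxExists`), read the target `OneClassOnCriticalCurve` at
`y = 0` through `xc 0 = hexCriticalFugacity` and `CornerLaw` as convergence in law of the
hexagonal critical SAW to a chordal SLE_{8/3} random curve `Γ`, and transfer it to the `δℤ²`
critical SAW with the same `Γ`: `∫ f dP^{ℤ²}_δ = (∫ f dP^{ℤ²}_δ − ∫ f dP^{Hex}_δ) + ∫ f dP^{Hex}_δ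
→ 0 + 𝔼 f(Γ)` by `LatticeUniversality`. Duminil-Copin–Smirnov 2012, §4, Conjecture 1 (hexagonal
phrasing); Lawler–Schramm–Werner 2004, §3.4.2 and Prediction 1 (square lattice). -/
theorem CornerTransfer_proof :
    Summit.CriticalPhenomena.SAWScalingLimit.Theses.SAWMassiveIsingTilt.CornerTransfer := by
  unfold Summit.CriticalPhenomena.SAWScalingLimit.Theses.SAWMassiveIsingTilt.CornerTransfer
  intro hCL hHE hOC hLU D a b hab
  -- a hexagonal endpoint approximation of the same Dobrushin domain
  obtain ⟨a', b', hab'⟩ := hHE D a b hab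
  -- expose the shared `let`s (Zloop, tilt, tiltLaw) of the target and of `CornerLaw`
  unfold OneClassOnCriticalCurve at hOC
  unfold CornerLaw at hCL
  dsimp only at hOC hCL
  obtain ⟨xc, hxc0, hconv⟩ := hOC
  -- `y = 0` lies in the parameter range `[0, 1/√3)` of the critical curve
  have hy : (0 : ℝ) ∈ Set.Ico (0 : ℝ) (Real.sqrt 3)⁻¹ :=
    ⟨le_rfl, inv_pos.2 (Real.sqrt_pos.2 (by norm_num))⟩
  -- the target at the SAW corner, rewritten as convergence of the hexagonal SAW law
  have hhex := hconv 0 hy D a' b' hab'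
  simp only [hxc0, hCL] at hhex
  obtain ⟨Γ, hΓ, -, hT⟩ := hhex
  refine ⟨Γ, hΓ, Eventually.of_forall fun δ ↦ SAW.aemeasurable_curve _ _ _ _, fun f ↦ ?_⟩
  -- `∫ f dP^{ℤ²} = (∫ f dP^{ℤ²} − ∫ f dP^{Hex}) + ∫ f dP^{Hex} → 0 + 𝔼 f(Γ)`
  have h1 := hLU D a b a' b' hab hab' f
  have h2 := hT f
  have h := h1.add h2
  simpa only [sub_add_cancel, zero_add] using h

end Summit.CriticalPhenomena.SAWScalingLimit.Theorems

end
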